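import Literature.NumberTheory.LFunctions.EulerMaclaurinZetaHigher
import HarnessLib

/-!
# Rational Euler–Maclaurin enclosures of `ζ(k)` at integers `k ≥ 2`

For the kernel certificate refuting [Xiao2020, Conj. 3.4] (`Xiao2020/Certificate.lean`) the values
`ζ(k)`, `2 ≤ k ≤ 119`, enter through `Σ_{j≥0}(2j+1)^{−k} = (1 − 2^{−k})ζ(k)`. At an integer
`s = k` the Euler–Maclaurin main terms of order `ν` ([Edwards1974, §6.4],
`riemannZeta_eq_eulerMaclaurin_of_re_pos`) are *rational*: `zetaNatMain N ν k ∈ ℚ`, written with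
`Finset.range` sums so that the kernel evaluates the very same expression; the remainder is bounded
by the rational `zetaNatTail N ν k` (`norm_emRemHigher_le`, keeping the factor `N^{−k}`).
Main result: `abs_re_riemannZeta_nat_sub_zetaNatMain_le`.

[cite: Xiao2020, Conj. 3.4] [cite: Edwards1974, §6.4]
-/

open Complex Finset
open scoped Nat
open Literature.NumberTheory.LFunctions

namespace Literature.NumberTheory.LFunctions.Xiao2020

/-- The Euler–Maclaurin main terms of order `ν` for `ζ(k)`, `k ≥ 2` an integer, as a rational number:
`Σ_{n<N} n^{−k} + N^{1−k}/(k−1) + N^{−k}/2 + Σ_{j≤ν} (B_{2j}/(2j)!) k(k+1)⋯(k+2j−2) N^{−(k+2j−1)}`.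
[cite: Edwards1974, §6.4] -/
def zetaNatMain (N ν k : ℕ) : ℚ :=
  (∑ m ∈ range (N - 1), 1 / ((m + 1 : ℕ) : ℚ) ^ k) +
  (N : ℚ) / ((N : ℚ) ^ k * ((k : ℚ) - 1)) + 1 / (2 * (N : ℚ) ^ k) +
  ∑ j ∈ range ν, bernoulli (2 * (j + 1)) / (2 * (j + 1))! *
    ((∏ i ∈ range (2 * (j + 1) - 1), (k + i) : ℕ) : ℚ) / (N : ℚ) ^ (k + (2 * (j + 1) - 1))

/-- The bound `k(k+1)⋯(k+2ν) · (33/10)(25/157)^{2ν+1} / (N^{k+2ν}(k+2ν))` for the Euler–Maclaurin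
remainder of order `ν` at `s = k`. [cite: Edwards1974, §6.4] -/
def zetaNatTail (N ν k : ℕ) : ℚ :=
  ((∏ i ∈ range (2 * ν + 1), (k + i) : ℕ) : ℚ) * ((33 / 10 : ℚ) * (25 / 157) ^ (2 * ν + 1)) *
    (1 / ((N : ℚ) ^ (k + 2 * ν) * ((k : ℚ) + 2 * ν)))

/-- At `s = k` the Pochhammer factor is the natural number `k(k+1)⋯(k+m−1)`. [folklore] -/
theorem emPoch_natCast (k m : ℕ) : emPoch (k : ℂ) m = ((∏ i ∈ range m, (k + i) : ℕ) : ℂ) := by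
  unfold emPoch
  push_cast
  rfl

/-- The main terms at `s = k`: `emMainZero N k + Σ_{j≤ν} emTerm N k j = zetaNatMain N ν k`.
[cite: Edwards1974, §6.4] -/
theorem emMainZero_add_sum_emTerm_natCast {N : ℕ} (hN : 1 ≤ N) (ν : ℕ) {k : ℕ} (hk : 2 ≤ k) :
    emMainZero N (k : ℂ) + ∑ j ∈ Icc 1 ν, emTerm N (k : ℂ) j = ((zetaNatMain N ν k : ℚ) : ℂ) := by
  have hN0 : (N : ℂ) ≠ 0 := by exact_mod_cast (show N ≠ 0 by omega)
  have hk1 : (k : ℂ) - 1 ≠ 0 := sub_ne_zero.2 (by exact_mod_cast (show k ≠ 1 by omega))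
  have hIcc : Icc 1 ν = Ico 1 (ν + 1) := by
    ext j
    simp only [mem_Icc, mem_Ico]
    omega
  have hA : ∑ n ∈ Ico 1 N, (n : ℂ) ^ (-(k : ℂ)) =
      ∑ m ∈ range (N - 1), (1 / ((m + 1 : ℕ) : ℂ) ^ k) := by
    rw [sum_Ico_eq_sum_range]
    refine sum_congr rfl fun m _ ↦ ?_
    rw [cpow_neg, cpow_natCast]
    push_cast
    ring
  have hB : (N : ℂ) ^ (1 - (k : ℂ)) / ((k : ℂ) - 1) = (N : ℂ) / ((N : ℂ) ^ k * ((k : ℂ) - 1)) := by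
    rw [cpow_sub _ _ hN0, cpow_one, cpow_natCast, div_div]
  have hC : (N : ℂ) ^ (-(k : ℂ)) / 2 = 1 / (2 * (N : ℂ) ^ k) := by
    rw [cpow_neg, cpow_natCast]
    field_simp
  have hD : ∑ j ∈ Icc 1 ν, emTerm N (k : ℂ) j =
      ∑ j ∈ range ν, ((bernoulli (2 * (j + 1)) : ℂ) / (2 * (j + 1))! *
        ((∏ i ∈ range (2 * (j + 1) - 1), (k + i) : ℕ) : ℂ) / (N : ℂ) ^ (k + (2 * (j + 1) - 1))) := by
    rw [hIcc, sum_Ico_eq_sum_range, show ν + 1 - 1 = ν from rfl]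
    refine sum_congr rfl fun j _ ↦ ?_
    rw [emTerm, emPoch_natCast, show -((k : ℂ) + ((2 * (1 + j) - 1 : ℕ) : ℂ)) =
      -(((k + (2 * (j + 1) - 1) : ℕ) : ℂ)) by push_cast; ring, cpow_neg, cpow_natCast,
      show 2 * (1 + j) = 2 * (j + 1) by ring]
    ring
  rw [emMainZero, hA, hB, hC, hD, zetaNatMain]
  push_cast
  ring

/-- `π²/3/(2π)^{2ν+1} ≤ (33/10)(25/157)^{2ν+1}`. [folklore] -/
theorem pi_sq_div_le_rat (ν : ℕ) :
    Real.pi ^ 2 / 3 / (2 * Real.pi) ^ (2 * ν + 1) ≤ (33 / 10 : ℝ) * (25 / 157) ^ (2 * ν + 1) := by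
  have hπ3 := Real.pi_gt_d2
  have hπ4 := Real.pi_lt_d4
  rw [div_le_iff₀ (by positivity)]
  have hA : Real.pi ^ 2 / 3 ≤ 33 / 10 := by nlinarith
  have hB : (1 : ℝ) ≤ (25 / 157) ^ (2 * ν + 1) * (2 * Real.pi) ^ (2 * ν + 1) := by
    rw [← mul_pow]
    exact one_le_pow₀ (by nlinarith)
  nlinarith

/-- The remainder at `s = k`: `|R_ν(k)| ≤ zetaNatTail N ν k`. [cite: Edwards1974, §6.4] -/
theorem norm_emRemHigher_natCast_le {N : ℕ} (hN : 1 ≤ N) {ν : ℕ} (hν : ν ≠ 0) {k : ℕ}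
    (hk : 2 ≤ k) : ‖emRemHigher N ν (k : ℂ)‖ ≤ ((zetaNatTail N ν k : ℚ) : ℝ) := by
  have hre : (0 : ℝ) < ((k : ℂ)).re := by
    rw [natCast_re]
    exact_mod_cast (show 0 < k by omega)
  refine (norm_emRemHigher_le hN hre hν).trans ?_
  have hN0 : (0 : ℝ) ≤ N := by positivity
  rw [emPoch_natCast, Complex.norm_natCast, natCast_re,
    show -((k : ℝ) + 2 * ν) = -(((k + 2 * ν : ℕ) : ℝ)) by push_cast; ring,
    Real.rpow_neg hN0, Real.rpow_natCast, zetaNatTail]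
  push_cast
  have hP : (0 : ℝ) ≤ ∏ i ∈ range (2 * ν + 1), ((k : ℝ) + i) := prod_nonneg fun i _ ↦ by positivity
  have h1 := pi_sq_div_le_rat ν
  have hQ : ((N : ℝ) ^ (k + 2 * ν))⁻¹ / ((k : ℝ) + 2 * ν) =
      1 / ((N : ℝ) ^ (k + 2 * ν) * ((k : ℝ) + 2 * ν)) := by
    rw [inv_eq_one_div, div_div]
  rw [hQ]
  gcongr

/-- **`ζ(k)` at integers, enclosed**: for `k ≥ 2`, `N ≥ 1`, `ν ≥ 1`,
`|Re ζ(k) − zetaNatMain N ν k| ≤ zetaNatTail N ν k`. [cite: Edwards1974, §6.4] -/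
theorem abs_re_riemannZeta_nat_sub_zetaNatMain_le {N : ℕ} (hN : 1 ≤ N) {ν : ℕ} (hν : ν ≠ 0)
    {k : ℕ} (hk : 2 ≤ k) :
    |(riemannZeta (k : ℂ)).re - (zetaNatMain N ν k : ℝ)| ≤ (zetaNatTail N ν k : ℝ) := by
  have hre : (0 : ℝ) < ((k : ℂ)).re := by
    rw [natCast_re]
    exact_mod_cast (show 0 < k by omega)
  have hk1 : (k : ℂ) ≠ 1 := by exact_mod_cast (show k ≠ 1 by omega)
  have hζ := riemannZeta_eq_eulerMaclaurin_of_re_pos hN hre hk1 ν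
  rw [emMainZero_add_sum_emTerm_natCast hN ν hk] at hζ
  have : (riemannZeta (k : ℂ)).re - (zetaNatMain N ν k : ℝ) = (emRemHigher N ν (k : ℂ)).re := by
    rw [hζ, add_re]
    simp
  rw [this]
  exact (abs_re_le_norm _).trans (norm_emRemHigher_natCast_le hN hν hk)

end Literature.NumberTheory.LFunctions.Xiao2020
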